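import Literature.NumberTheory.GaloisRepresentations.ContinuousShapiroLiftPairing
import Literature.NumberTheory.GaloisRepresentations.LocalTatePairing
import HarnessLib

/-!
# The finite coinduced DISCRETE GALOIS MODULE `Maps(Γ_K ⧸ U, M)` and its Tate dual: the summed pairing as a
# morphism `Maps(Γ_K ⧸ U, M') ⟶ Maps(Γ_K ⧸ U, M)^D`

Topic `NumberTheory/GaloisRepresentations` (namespace = path; dot-notation under `DiscreteGaloisModule`). DEFINITIONS
WITH BODIES and their unfolding / structural theorems; no named fact, no instance, no notation, no `sorry`.

Let `K` be a field, `ρ : Γ_K → Aut(M)` a discrete Galois module (`DiscreteGaloisModule K M`) and `U ≤ Γ_K` an OPEN subgroup of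
finite index (a `Fintype (Γ_K ⧸ U)` is taken as an instance argument, as in the Shapiro files).  The tree's
`coindFin ρ.toTopRep U` (`ContinuousShapiroLift.lean`) is the topological representation of `Γ_K` on the functions
`Γ_K ⧸ U → M`, `(g ⋆ φ)(y) = g • φ(g⁻¹ • y)` — for `U = Γ_L` the induced/coinduced module `Ind_{Γ_L}^{Γ_K} M` of Shapiro's
lemma (Serre, *Local Fields* VII §5–§6; Neukirch–Schmidt–Wingberg I §6).  The arithmetic-duality files of the tree
(`LocalGlobalCohomology.lean`: `tateDual`, `SelmerStructure`; `LocalTatePairing.lean`; `GaloisCohomology/PoitouTate*.lean`)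
speak of `DiscreteGaloisModule`s.  This file bridges the two:

* §1 `DiscreteGaloisModule.coind ρ U hU : DiscreteGaloisModule K (Γ_K ⧸ U → M)` — the SAME action, packaged as a discrete
  Galois module (continuity: the stabiliser of `φ` contains the open `⋂_y (Stab(y) ∩ Stab_ρ(φ y))`), with
  **`(ρ.coind U hU).toTopRep = coindFin ρ.toTopRep U` definitionally** (`toTopRep_coind`), so that
  `galoisCohomology (ρ.coind U hU) n` IS `continuousCohomology n (coindFin ρ.toTopRep U)` and the tree's Shapiro lift
  `shapiroLift` lands in it.
* §2 For an equivariant bi-additive `B : M × M' → μₙ` (`B (ρ σ m) (ρ' σ m') = σ • B m m'`): the **summed-pairing duality map**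
  `coindTateDualHom B : Maps(Γ_K ⧸ U, M') →+ Maps(Γ_K ⧸ U, M)^D = Hom(Maps(Γ_K ⧸ U, M), μₙ)`, `ψ ↦ (φ ↦ Σ_y B(φ y, ψ y))`;
  it is `Γ_K`-equivariant for the Tate-dual action (`coindTateDualHom_smul`), whence a morphism of topological representations
  `coindTateDualMor : coindFin ρ'.toTopRep U ⟶ ((ρ.coind U hU).tateDual n).toTopRep`; the evaluation pairing pulls back to the
  summed pairing, `⟨φ, Ψ ψ⟩_{ev} = Σ_y B(φ y, ψ y) = (P.coindFin U)(φ, ψ)` (`tateDualEval_coindTateDualHom`,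
  `tateDualPairing_toLin_coindTateDualMor`) — whence, by the tree's adjoint naturality `ContPairing.cupProduct_adjoint`,
  `a ∪_{ev} H¹(Ψ) b = a ∪_{ΣB} b` in `H²(Γ_K, μₙ)` (proved in the companion `…Proofs` file, which needs cup products).
* §3 `Ψ` is injective, resp. bijective, as soon as `m' ↦ B(·, m') : M' → M^D` is (`coindTateDualHom_injective`,
  `coindTateDualHom_bijective`: `Hom(⊕_y M, μₙ) = ∏_y Hom(M, μₙ)`).

Motivation (consumer, not used here): for an elliptic curve `E/ℚ`, `M = M' = E[N]` and `B` the Weil pairing, this identifies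
`Maps(Γ_ℚ ⧸ Γ_n, E[N])` with its own Tate dual, so that Poitou–Tate duality for Selmer structures over `ℚ`
(`LocalInvariants.SelmerComplement`, Milne *ADT* I Thm. 4.10 / Howard 2004 Thm. 2.1.11) can be read, through Shapiro's lemma,
on the cohomology `H¹(Γ_n, E[N])` of the layers `ℚ_n` of the cyclotomic `ℤ_p`-tower (Kobayashi 2003 §7; Kato 2004 §13.8).

## References

* J.-P. Serre, *Local Fields* (1979), VII §5–§6 (induced modules, Shapiro's lemma). [SerreLocalFields1979]
* J. Neukirch, A. Schmidt, K. Wingberg, *Cohomology of Number Fields*, 2nd ed. (2008), I §5 Prop. (1.5.3)(iv), I §6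
  (induced modules, Prop. (1.6.4)); VII §2 (the dual `A' = Hom(A, μ)`). [NeukirchSchmidtWingberg2008]
* J. S. Milne, *Arithmetic Duality Theorems*, 2nd ed. (2006), I §0 (pairings, `M^D`), I Cor. 2.3. [MilneADT2006]

## Design notes

* `[Fintype (Γ_K ⧸ U)]` is an instance ARGUMENT (the tree's `coindFin`/`ContPairing.coindFin` pattern): it supplies
  `Finite`/`DiscreteTopology` of `Γ_K ⧸ U → M` (Mathlib's `Pi` instances) and the finite sums; no instance is declared here.
* Openness of `U` is what makes the coinduced action continuous for the discrete topology; it is a hypothesis of `coind`.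
* Universe: `M M' : Type u` (the universe of `K`), as in `LocalTatePairing.lean`; `coindFin.{0, u}` is written with its
  universes pinned (as the Shapiro files write `coindFin.{u, v}`), which keeps `continuousCohomology n (coindFin …)` from
  leaving a `max ?u ?v = u` universe constraint behind.
* NOT here: cup products (no `LocallyCompactSpace Γ_K` instance is used in this file), Selmer structures, anything local.

## Tree search / relation to existing files

`lean search 'DiscreteGaloisModule.*coind|coindModule|def coind '`.  The tree has THREE models of induction, for different jobs:
(i) `coindFin X N` (`ContinuousShapiroLift.lean`): functions on the FINITE coset space `G ⧸ N` of a `G`-representation — the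
model of the Shapiro-lift files (`shapiroLift`, `ContPairing.coindFin`, `coindFinPull`, …) and of the cyclotomic-layer Tate
pairings (`EllipticCurves/CyclotomicLayerTatePairing.lean`); (ii) Serre's `M_G^S(A) ⊆ C(G, A)` for an `S`-module, `S` closed
(`CoinducedModule.lean`: `coindModule`, `coindRep`, for cohomological dimension); (iii) the `Rep`-valued `DiscreteRepCat … coind`
(`Literature/Algebra/Homology/DiscreteRepCoinduced.lean`).  This file adds NO fourth model: `coind` is model (i) VERBATIM
(`toTopRep_coind` is `rfl`), only re-packaged as a `DiscreteGaloisModule` so that `tateDual`, `SelmerStructure`,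
`localTatePairingZMod` and the Poitou–Tate predicates apply to it; nothing of (ii)/(iii) is restated.  Inputs reused:
`coindFin`/`coindFinRep`, `ContPairing.coindFin`, `DiscreteGaloisModule.tateDual`, `tateDualEval`, `tateDualPairing`,
`DiscreteGaloisModule.pairing`, `ContinuousRep.ofStabilizerMemNhdsOne`.
-/

noncomputable section

open CategoryTheory Function Field
open scoped Topology

universe u

namespace Literature.NumberTheory.GaloisRepresentations

namespace DiscreteGaloisModule

variable {K : Type u} [Field K] {M M' : Type u} [AddCommGroup M] [TopologicalSpace M] [DiscreteTopology M]
  [AddCommGroup M'] [TopologicalSpace M'] [DiscreteTopology M']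
  (ρ : DiscreteGaloisModule K M) (ρ' : DiscreteGaloisModule K M')
  (U : Subgroup (absoluteGaloisGroup K)) [Fintype (absoluteGaloisGroup K ⧸ U)]

/-! ## §1 The coinduced discrete Galois module `Maps(Γ_K ⧸ U, M)` -/

/-- **The finite coinduced discrete Galois module** `Maps(Γ_K ⧸ U, M)` of a discrete Galois module `M` along an open
subgroup `U ≤ Γ_K` of finite index: `Γ_K` acts by `(g ⋆ φ)(y) = g • φ(g⁻¹ • y)` — the action of the tree's
`coindFin ρ.toTopRep U` (`toTopRep_coind`).  For `U = Γ_L`, `L/K` finite, this is the induced module `Ind_{Γ_L}^{Γ_K} M`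
(`≅ M ⊗ ℤ[Gal(L/K)]` with the diagonal action) of Shapiro's lemma `Hⁿ(K, Ind M) ≅ Hⁿ(L, M)`.  Continuity: the stabiliser of
`φ` contains `⋂_{y} ({σ | σ • y = y} ∩ Stab_ρ(φ y))`, a neighbourhood of `1` (`U` open, `Γ_K ⧸ U` finite, `ρ` discrete).
[cite: SerreLocalFields1979, VII §5–§6] -/
def coind (hU : IsOpen (U : Set (absoluteGaloisGroup K))) : DiscreteGaloisModule K (absoluteGaloisGroup K ⧸ U → M) :=
  ContinuousRep.ofStabilizerMemNhdsOne (coindFinRep ρ.toTopRep U).toRepresentation fun φ => by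
    -- for `σ` near `1`: `σ` fixes every coset `y` (as `U` is open) and every value `φ y` (as `ρ` is discrete)
    have hcos : ∀ y : absoluteGaloisGroup K ⧸ U, ∀ᶠ σ in 𝓝 (1 : absoluteGaloisGroup K), σ⁻¹ • y = y := fun y => by
      induction y using QuotientGroup.induction_on with
      | H g =>
        have hc : Continuous fun σ : absoluteGaloisGroup K => g⁻¹ * σ * g :=
          (continuous_const.mul continuous_id).mul continuous_const
        have hmem : (fun σ : absoluteGaloisGroup K => g⁻¹ * σ * g) ⁻¹' (U : Set (absoluteGaloisGroup K)) ∈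
            𝓝 (1 : absoluteGaloisGroup K) :=
          hc.continuousAt.preimage_mem_nhds (by simpa only [mul_one, inv_mul_cancel] using hU.mem_nhds U.one_mem)
        filter_upwards [hmem] with σ hσ
        rw [MulAction.Quotient.smul_coe, QuotientGroup.eq, smul_eq_mul, mul_inv_rev, inv_inv]
        exact hσ
    have hval : ∀ y : absoluteGaloisGroup K ⧸ U, ∀ᶠ σ in 𝓝 (1 : absoluteGaloisGroup K), ρ σ (φ y) = φ y := fun y =>
      ρ.setOf_apply_eq_mem_nhds_one (φ y)
    filter_upwards [Filter.eventually_all.2 hcos, Filter.eventually_all.2 hval] with σ hσ hσ'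
    funext y
    change (ρ.toTopRep).ρ σ (φ (σ⁻¹ • y)) = φ y
    rw [hσ y]
    exact hσ' y

/-- The action of `Maps(Γ_K ⧸ U, M)`: `(g ⋆ φ)(y) = g • φ(g⁻¹ • y)`. [cite: NeukirchSchmidtWingberg2008, I §6] -/
@[simp] theorem coind_apply_apply (hU : IsOpen (U : Set (absoluteGaloisGroup K))) (g : absoluteGaloisGroup K) (φ : absoluteGaloisGroup K ⧸ U → M)
    (y : absoluteGaloisGroup K ⧸ U) : ρ.coind U hU g φ y = ρ g (φ (g⁻¹ • y)) := rfl

/-- **`Maps(Γ_K ⧸ U, M)` as a discrete Galois module IS the tree's `coindFin`** as a topological representation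
(definitionally): hence `galoisCohomology (ρ.coind U hU) n = continuousCohomology n (coindFin ρ.toTopRep U)` and the Shapiro lift
`shapiroLift ρ.toTopRep U … : H¹(U, M) → H¹(Γ_K, Maps(Γ_K ⧸ U, M))` takes values in `galoisCohomology (ρ.coind U hU) 1`.
[cite: NeukirchSchmidtWingberg2008, I §6 Prop. (1.6.4)] -/
theorem toTopRep_coind (hU : IsOpen (U : Set (absoluteGaloisGroup K))) :
    (ρ.coind U hU).toTopRep = coindFin.{0, u} ρ.toTopRep U := rfl

/-! ## §2 The summed-pairing duality map `Maps(Γ_K ⧸ U, M') → Maps(Γ_K ⧸ U, M)^D` -/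

section Dual

variable {n : ℕ} (B : M →+ M' →+ MuCarrier K n)

omit [TopologicalSpace M] [DiscreteTopology M] [TopologicalSpace M'] [DiscreteTopology M'] in
/-- **The summed-pairing duality map** `Ψ : Maps(Γ_K ⧸ U, M') →+ Hom(Maps(Γ_K ⧸ U, M), μₙ)`,
`Ψ(ψ)(φ) = Σ_{y ∈ Γ_K ⧸ U} B(φ y, ψ y)` for a bi-additive `B : M × M' → μₙ` (the coordinatewise duality
`Hom(⊕_y M, μₙ) = ∏_y Hom(M, μₙ)` composed with `m' ↦ B(·, m')`). [cite: NeukirchSchmidtWingberg2008, I §5 Prop. (1.5.3)(iv)]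
[cite: MilneADT2006, Ch. I §0] -/
def coindTateDualHom : (absoluteGaloisGroup K ⧸ U → M') →+ TateDual K (absoluteGaloisGroup K ⧸ U → M) n where
  toFun ψ := (AddMonoidHom.mk' (fun φ => ∑ y : absoluteGaloisGroup K ⧸ U, B (φ y) (ψ y)) fun φ φ' => by
      rw [← Finset.sum_add_distrib]
      exact Finset.sum_congr rfl fun y _ => by rw [Pi.add_apply, map_add, AddMonoidHom.add_apply] :
    (absoluteGaloisGroup K ⧸ U → M) →+ MuCarrier K n)
  map_zero' := TateDual.ext fun φ => by
    change (∑ y : absoluteGaloisGroup K ⧸ U, B (φ y) ((0 : absoluteGaloisGroup K ⧸ U → M') y)) = 0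
    exact Finset.sum_eq_zero fun y _ => by rw [Pi.zero_apply, map_zero]
  map_add' ψ ψ' := TateDual.ext fun φ => by
    change (∑ y : absoluteGaloisGroup K ⧸ U, B (φ y) ((ψ + ψ') y)) =
      (∑ y : absoluteGaloisGroup K ⧸ U, B (φ y) (ψ y)) + ∑ y : absoluteGaloisGroup K ⧸ U, B (φ y) (ψ' y)
    rw [← Finset.sum_add_distrib]
    exact Finset.sum_congr rfl fun y _ => by rw [Pi.add_apply, map_add]

omit [TopologicalSpace M] [DiscreteTopology M] [TopologicalSpace M'] [DiscreteTopology M'] in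
/-- Values of `Ψ`: `Ψ(ψ)(φ) = Σ_y B(φ y, ψ y)`. [cite: NeukirchSchmidtWingberg2008, I §5 Prop. (1.5.3)(iv)] -/
@[simp] theorem coindTateDualHom_apply_apply (ψ : absoluteGaloisGroup K ⧸ U → M') (φ : absoluteGaloisGroup K ⧸ U → M) :
    coindTateDualHom U B ψ φ = ∑ y : absoluteGaloisGroup K ⧸ U, B (φ y) (ψ y) := rfl

omit [Fintype (absoluteGaloisGroup K ⧸ U)] in
/-- Equivariance of `B` read with `σ⁻¹` on the first argument: `B(m, σ m') = σ • B(σ⁻¹ m, m')`. [cite: MilneADT2006, Ch. I §0] -/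
theorem apply_apply_eq_mu_inv
    (hB : ∀ (σ : absoluteGaloisGroup K) (m : M) (m' : M'), B (ρ σ m) (ρ' σ m') = mu K n σ (B m m'))
    (σ : absoluteGaloisGroup K) (m : M) (m' : M') :
    B m (ρ' σ m') = mu K n σ (B (ρ σ⁻¹ m) m') := by
  rw [← hB σ (ρ σ⁻¹ m) m', ← Module.End.mul_apply, ← map_mul, mul_inv_cancel, map_one, Module.End.one_apply]

/-- **`Ψ` is `Γ_K`-equivariant** for the coinduced action on `Maps(Γ_K ⧸ U, M')` and the Tate-dual action
`(σ F)(φ) = σ • F(σ⁻¹ ⋆ φ)` on `Hom(Maps(Γ_K ⧸ U, M), μₙ)`: `Ψ(σ ⋆ ψ) = σ • Ψ(ψ)` (reindex the sum by `y ↦ σ • y`).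
[cite: MilneADT2006, Ch. I §0] [cite: NeukirchSchmidtWingberg2008, I §6] -/
theorem coindTateDualHom_smul [Finite M] (hU : IsOpen (U : Set (absoluteGaloisGroup K)))
    (hB : ∀ (σ : absoluteGaloisGroup K) (m : M) (m' : M'), B (ρ σ m) (ρ' σ m') = mu K n σ (B m m'))
    (σ : absoluteGaloisGroup K) (ψ : absoluteGaloisGroup K ⧸ U → M') :
    coindTateDualHom U B (ρ'.coind U hU σ ψ) = (ρ.coind U hU).tateDual n σ (coindTateDualHom U B ψ) := by
  refine TateDual.ext fun φ => ?_
  change (∑ y : absoluteGaloisGroup K ⧸ U, B (φ y) (ρ' σ (ψ (σ⁻¹ • y))) : MuCarrier K n) =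
    mu K n σ (∑ x : absoluteGaloisGroup K ⧸ U, B (ρ σ⁻¹ (φ (σ⁻¹⁻¹ • x))) (ψ x))
  rw [map_sum, inv_inv]
  simp_rw [← apply_apply_eq_mu_inv ρ ρ' B hB]
  exact Fintype.sum_equiv (MulAction.toPerm σ⁻¹) _ _ fun y => by rw [MulAction.toPerm_apply, smul_inv_smul]

/-- **`Ψ` as a morphism of topological representations** `Maps(Γ_K ⧸ U, M') ⟶ Maps(Γ_K ⧸ U, M)^D` (source: the tree's
`coindFin ρ'.toTopRep U`; target: the Tate dual of `ρ.coind U hU` as a `TopRep`). [cite: MilneADT2006, Ch. I §0]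
[cite: NeukirchSchmidtWingberg2008, I §6] -/
def coindTateDualMor [Finite M] (hU : IsOpen (U : Set (absoluteGaloisGroup K)))
    (hB : ∀ (σ : absoluteGaloisGroup K) (m : M) (m' : M'), B (ρ σ m) (ρ' σ m') = mu K n σ (B m m')) :
    coindFin.{0, u} ρ'.toTopRep U ⟶ ((ρ.coind U hU).tateDual n).toTopRep :=
  TopRep.ofHom
    { toContinuousLinearMap :=
        { toLinearMap := (coindTateDualHom U B).toIntLinearMap
          cont := continuous_of_discreteTopology }
      isIntertwining' := fun σ => by
        ext ψ : 1
        exact coindTateDualHom_smul ρ ρ' U B hU hB σ ψ }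

/-- Values of `coindTateDualMor`. [cite: NeukirchSchmidtWingberg2008, I §6] -/
@[simp] theorem coindTateDualMor_hom_apply [Finite M] (hU : IsOpen (U : Set (absoluteGaloisGroup K)))
    (hB : ∀ (σ : absoluteGaloisGroup K) (m : M) (m' : M'), B (ρ σ m) (ρ' σ m') = mu K n σ (B m m'))
    (ψ : absoluteGaloisGroup K ⧸ U → M') :
    (coindTateDualMor ρ ρ' U B hU hB).hom ψ = coindTateDualHom U B ψ := rfl

omit [TopologicalSpace M] [DiscreteTopology M] [TopologicalSpace M'] [DiscreteTopology M'] in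
/-- **The evaluation pairing pulls back to the summed pairing along `Ψ`**: `⟨φ, Ψ ψ⟩_{ev} = Σ_y B(φ y, ψ y)`.
[cite: NeukirchSchmidtWingberg2008, I §5 Prop. (1.5.3)(iv)] -/
theorem tateDualEval_coindTateDualHom (φ : absoluteGaloisGroup K ⧸ U → M) (ψ : absoluteGaloisGroup K ⧸ U → M') :
    tateDualEval K (absoluteGaloisGroup K ⧸ U → M) n φ (coindTateDualHom U B ψ) =
      ∑ y : absoluteGaloisGroup K ⧸ U, B (φ y) (ψ y) := by
  rw [tateDualEval_apply, coindTateDualHom_apply_apply]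

/-- The same on the continuous pairings of the tree: `(tateDualPairing (coind ρ)).toLin φ (Ψ ψ) = (P.coindFin U).toLin φ ψ` for
`P = pairing ρ ρ' μₙ B`. [cite: NeukirchSchmidtWingberg2008, I §5 Prop. (1.5.3)(iv)] -/
theorem tateDualPairing_toLin_coindTateDualMor [Finite M] (hU : IsOpen (U : Set (absoluteGaloisGroup K)))
    (hB : ∀ (σ : absoluteGaloisGroup K) (m : M) (m' : M'), B (ρ σ m) (ρ' σ m') = mu K n σ (B m m'))
    (φ : absoluteGaloisGroup K ⧸ U → M) (ψ : absoluteGaloisGroup K ⧸ U → M') :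
    (tateDualPairing (ρ.coind U hU) n).toLin φ ((coindTateDualMor ρ ρ' U B hU hB).hom ψ) =
      ((pairing ρ ρ' (mu K n) B hB).coindFin U).toLin φ ψ := by
  rw [coindTateDualMor_hom_apply, ContPairing.coindFin_toLin_apply]
  rfl

end Dual

/-! ## §3 Injectivity and bijectivity of `Ψ` -/

section Bijective

variable {n : ℕ} (B : M →+ M' →+ MuCarrier K n)

omit [TopologicalSpace M] [DiscreteTopology M] [TopologicalSpace M'] [DiscreteTopology M'] in
/-- **`Ψ` is injective when `m' ↦ B(·, m')` is** (e.g. `B` non-degenerate on the right): test against `φ = δ_y m`.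
[cite: MilneADT2006, Ch. I §0] -/
theorem coindTateDualHom_injective (hinj : Injective fun m' : M' => B.flip m') :
    Injective (coindTateDualHom U B) := by
  classical
  intro ψ ψ' h
  funext y₀
  apply hinj
  ext m
  have := congrArg (fun F : TateDual K (absoluteGaloisGroup K ⧸ U → M) n => F (Pi.single y₀ m)) h
  simp only [coindTateDualHom_apply_apply] at this
  rw [Finset.sum_eq_single y₀ (fun y _ hy => by rw [Pi.single_eq_of_ne hy, map_zero, AddMonoidHom.zero_apply])
      (fun hy => absurd (Finset.mem_univ y₀) hy),
    Finset.sum_eq_single y₀ (fun y _ hy => by rw [Pi.single_eq_of_ne hy, map_zero, AddMonoidHom.zero_apply])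
      (fun hy => absurd (Finset.mem_univ y₀) hy), Pi.single_eq_same] at this
  exact this

omit [TopologicalSpace M] [DiscreteTopology M] [TopologicalSpace M'] [DiscreteTopology M'] in
/-- **`Ψ` is surjective when `m' ↦ B(·, m') : M' → Hom(M, μₙ)` is**: a character `F` of `Maps(Γ_K ⧸ U, M)` is `Ψ(ψ)` for
`ψ(y)` any preimage of `F ∘ δ_y` (`F(φ) = Σ_y F(δ_y (φ y))`). [cite: MilneADT2006, Ch. I §0] -/
theorem coindTateDualHom_surjective (hsurj : Surjective fun m' : M' => B.flip m') :
    Surjective (coindTateDualHom U B) := by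
  classical
  intro F
  have hF : ∀ y : absoluteGaloisGroup K ⧸ U, ∃ m' : M', B.flip m' =
      (F : (absoluteGaloisGroup K ⧸ U → M) →+ MuCarrier K n).comp (AddMonoidHom.single (fun _ => M) y) := fun y => hsurj _
  choose ψ hψ using hF
  refine ⟨ψ, TateDual.ext fun φ => ?_⟩
  rw [coindTateDualHom_apply_apply]
  have hφ : φ = ∑ y : absoluteGaloisGroup K ⧸ U, Pi.single y (φ y) := (Finset.univ_sum_single φ).symm
  conv_rhs => rw [hφ, map_sum]
  refine Finset.sum_congr rfl fun y _ => ?_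
  have := DFunLike.congr_fun (hψ y) (φ y)
  rw [AddMonoidHom.flip_apply] at this
  rw [this]
  rfl

omit [TopologicalSpace M] [DiscreteTopology M] [TopologicalSpace M'] [DiscreteTopology M'] in
/-- **`Ψ` is bijective when `m' ↦ B(·, m') : M' ⥲ Hom(M, μₙ)` is** (a perfect `B`, e.g. the Weil pairing on `E[n]`):
`Maps(Γ_K ⧸ U, M') ≅ Maps(Γ_K ⧸ U, M)^D`. [cite: MilneADT2006, Ch. I §0, Cor. 2.3] -/
theorem coindTateDualHom_bijective (hbij : Bijective fun m' : M' => B.flip m') :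
    Bijective (coindTateDualHom U B) :=
  ⟨coindTateDualHom_injective U B hbij.1, coindTateDualHom_surjective U B hbij.2⟩

end Bijective

end DiscreteGaloisModule

end Literature.NumberTheory.GaloisRepresentations

end
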